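import Mathlib.Analysis.InnerProductSpace.l2Space
import Mathlib.Analysis.Normed.Lp.lpSpace
import Mathlib.Analysis.InnerProductSpace.Adjoint
import Mathlib.Analysis.InnerProductSpace.LinearPMap
import Literature.Analysis.UnboundedOperators.SymmetricPMap
import Literature.Analysis.UnboundedOperators.SpectralGap
import HarnessLib

-- provenance: harness21/H21/H21/Prelude/UnbddOp/DiagonalOperator.lean @ 7a08ad6 (interim HEAD d8f2665); M5 mechanical rewrite
/-!
# Diagonal operators in a Hilbert basis

Trunk: UnbddOp (prelude item C6 `DiagonalOperator`; notions `hilbert_polya_operator`,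
`heat_semigroup`; intended carrier of the torus Stokes operator).

Given a Hilbert basis `b : HilbertBasis ι 𝕜 H` (Mathlib: an identification
`b.repr : H ≃ₗᵢ[𝕜] ℓ²(ι, 𝕜)`) and a *symbol* `m : ι → 𝕜`, the diagonal operator
`diag(m)` acts by `b i ↦ m i • b i`, i.e. by pointwise multiplication `c ↦ m * c` in
coordinates. We provide

* `HilbertBasis.diagonalDomain b m`: the maximal domain `{x | (m i * ⟪b i, x⟫)_i ∈ ℓ²}`;
* `HilbertBasis.diagonalPMap b m : H →ₗ.[𝕜] H`: the (in general unbounded) maximal diagonal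
  operator (Reed–Simon, *Methods of Modern Mathematical Physics I*, §VIII.1, Example 1 and
  §VIII.3, Proposition 1: multiplication operators are self-adjoint on their maximal domain);
* `HilbertBasis.diagonalCLM b m : H →L[𝕜] H` for a bounded symbol `m ∈ ℓ^∞(ι, 𝕜)`, with
  `‖diag(m)‖ ≤ ‖m‖_∞`, `diag(1) = 1`, `diag(m n) = diag(m) diag(n)`, `diag(m)† = diag(m̄)`
  (Halmos, *A Hilbert Space Problem Book*, Problems 61–63; Conway, *A Course in Functional
  Analysis*, II Proposition 1.5 / VIII Example 3.2 ff.),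

together with the eigen- and spectral API used by the Hilbert–Pólya and heat-semigroup statements
(eigenvectors `b i`, eigenvalues `range m`, spectrum `closure (range m)`, positivity iff
`0 ≤ re m`, and the ground-state-gap sanity check against `LinearPMap.HasGroundStateGap`).

## Mathlib

Used without redefinition: `HilbertBasis`, `HilbertBasis.repr`, `HilbertBasis.repr_self`,
`lp`, `Memℓp`, `Memℓp.mono`, `lp.norm_mono`, `lp.norm_apply_le_norm`, the ring / star
structure on `lp B ∞` (`lp.inftyRing`, `lp.inftyStarRing`), `LinearMap.mkContinuous`,
`LinearMap.toPMap`, `ContinuousLinearMap.adjoint`, `spectrum`, and the H21 prelude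
(`LinearPMap.IsSymmetric`, `IsPositive`, `eigenspace`, `HasEigenvalue`, `HasEigenvector`,
`HasGroundStateGap`). Mathlib has no diagonal / multiplication operator attached to a Hilbert
basis (searched `diagonal`, `HilbertBasis`, `mulCLM` in `Analysis/InnerProductSpace/l2Space.lean`,
`Analysis/Normed/Lp/lpSpace.lean`); `Memℓp.infty_mul` is the `ℓ^∞ · ℓ^∞` case only, so the
`ℓ^∞ · ℓ^p ⊆ ℓ^p` estimate is proved here (`Memℓp.infty_mul_left`) from `Memℓp.mono`.

## Design choices

* All declarations are deliberate dot-notation extensions in Mathlib's `namespace HilbertBasis`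
  (plus one lemma in `namespace Memℓp`); each docstring says so.
* Generality `[RCLike 𝕜]`, arbitrary index type `ι`; `[CompleteSpace H]` only where Mathlib's
  `IsSelfAdjoint` on `LinearPMap` / `ContinuousLinearMap.adjoint` need it (a space carrying a
  Hilbert basis is complete anyway, being isometric to `ℓ²`).
* "`m` is real" is phrased `IsSelfAdjoint m` (`star m = m` by `Iff.rfl`).
* `diagonalPMap` is defined on its *maximal* domain, so that for real `m` it is self-adjoint,
  not merely essentially self-adjoint.
-/

noncomputable section

open RCLike Submodule

open scoped ComplexConjugate InnerProductSpace ENNReal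

/-! ### An `ℓ^∞ · ℓ^p` estimate -/

namespace Memℓp

variable {ι 𝕜 : Type*} [NormedRing 𝕜] {p : ℝ≥0∞}

/-- (Dot-notation extension of Mathlib's `Memℓp`.) A bounded sequence times an `ℓ^p` sequence
is `ℓ^p`: `‖m c‖_p ≤ ‖m‖_∞ ‖c‖_p` (Hölder with exponents `∞, p`; compare Mathlib's
`Memℓp.infty_mul`, which is the case `p = ∞`). [folklore] -/
theorem infty_mul_left {m c : ι → 𝕜} (hm : Memℓp m ∞) (hc : Memℓp c p) :
    Memℓp (fun i => m i * c i) p := by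
  obtain ⟨C, hC⟩ := hm.bddAbove
  refine (hc.norm.const_mul C).mono fun i => ?_
  exact (norm_mul_le _ _).trans (mul_le_mul_of_nonneg_right (hC ⟨i, rfl⟩) (norm_nonneg _))

end Memℓp

namespace HilbertBasis

variable {ι 𝕜 H : Type*} [RCLike 𝕜] [NormedAddCommGroup H] [InnerProductSpace 𝕜 H]
variable (b : HilbertBasis ι 𝕜 H)

local notation "⟪" x ", " y "⟫" => inner 𝕜 x y

/-! ### The maximal domain -/

section Domain

/-- (Dot-notation extension of Mathlib's `HilbertBasis`.) The maximal domain of the diagonal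
operator with symbol `m : ι → 𝕜` in the Hilbert basis `b`: the vectors `x` whose coordinate
sequence multiplied by `m` is still square-summable, `{x | (m i * ⟪b i, x⟫)_i ∈ ℓ²(ι, 𝕜)}`
(Reed–Simon I, §VIII.3, Proposition 1: the maximal domain of a multiplication operator). [folklore] -/
def diagonalDomain (m : ι → 𝕜) : Submodule 𝕜 H where
  carrier := {x | Memℓp (fun i => m i * b.repr x i) 2}
  zero_mem' := by simpa using (zero_mem_ℓp' : Memℓp (fun _ : ι => (0 : 𝕜)) 2)
  add_mem' {x y} hx hy := by
    have h := hx.add hy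
    simp only [Pi.add_def] at h
    simpa only [Set.mem_setOf_eq, map_add, lp.coeFn_add, Pi.add_apply, mul_add] using h
  smul_mem' c x hx := by
    simpa only [Set.mem_setOf_eq, LinearIsometryEquiv.map_smul, lp.coeFn_smul, Pi.smul_apply,
      smul_eq_mul, mul_left_comm (m _) c] using hx.const_mul c

variable {b} in
/-- Membership in the diagonal domain (by definition). [folklore] -/
theorem mem_diagonalDomain_iff {m : ι → 𝕜} {x : H} :
    x ∈ b.diagonalDomain m ↔ Memℓp (fun i => m i * b.repr x i) 2 :=
  Iff.rfl

/-- The basis vectors lie in every diagonal domain (their coordinate sequences are finitely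
supported). [folklore] -/
theorem basis_mem_diagonalDomain (m : ι → 𝕜) (i : ι) : b i ∈ b.diagonalDomain m := by
  classical
  rw [mem_diagonalDomain_iff, b.repr_self]
  have : (fun j => m j * lp.single (E := fun _ : ι => 𝕜) 2 i (1 : 𝕜) j) =
      ⇑(lp.single (E := fun _ : ι => 𝕜) 2 i (m i)) := by
    ext j
    by_cases h : j = i
    · subst h; simp
    · simp [Pi.single_eq_of_ne h]
  rw [this]
  exact lp.memℓp _

/-- The finite linear span of the basis is contained in every diagonal domain. [folklore] -/
theorem span_range_le_diagonalDomain (m : ι → 𝕜) :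
    span 𝕜 (Set.range b) ≤ b.diagonalDomain m :=
  span_le.mpr (Set.range_subset_iff.mpr (b.basis_mem_diagonalDomain m))

/-- The diagonal domain is dense (it contains the span of the basis, `HilbertBasis.dense_span`;
Reed–Simon I, §VIII.3). [folklore] -/
theorem dense_diagonalDomain (m : ι → 𝕜) : Dense (b.diagonalDomain m : Set H) := by
  rw [dense_iff_topologicalClosure_eq_top, eq_top_iff, ← b.dense_span]
  exact topologicalClosure_mono (b.span_range_le_diagonalDomain m)

/-- For a bounded symbol the diagonal domain is everything (`ℓ^∞ · ℓ² ⊆ ℓ²`). [folklore] -/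
theorem diagonalDomain_eq_top_of_memℓp_infty {m : ι → 𝕜} (hm : Memℓp m ∞) :
    b.diagonalDomain m = ⊤ :=
  eq_top_iff.mpr fun x _ => hm.infty_mul_left (lp.memℓp (b.repr x))

end Domain

/-! ### The unbounded diagonal operator -/

section PMap

/-- (Dot-notation extension of Mathlib's `HilbertBasis`.) The maximal diagonal operator with
symbol `m : ι → 𝕜` in the Hilbert basis `b`, as a partially defined operator on
`b.diagonalDomain m`: `x ↦ ∑ m i ⟪b i, x⟫ b i`, i.e. `b.repr.symm (m * b.repr x)`
(Reed–Simon I, §VIII.1 Example 1 and §VIII.3 Proposition 1). [folklore] -/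
def diagonalPMap (m : ι → 𝕜) : H →ₗ.[𝕜] H where
  domain := b.diagonalDomain m
  toFun :=
    { toFun := fun x => b.repr.symm ⟨fun i => m i * b.repr (x : H) i, x.2⟩
      map_add' := fun x y => by
        rw [← map_add]
        congr 1
        ext i
        simp [mul_add]
      map_smul' := fun c x => by
        rw [RingHom.id_apply, ← LinearIsometryEquiv.map_smul]
        congr 1
        ext i
        simp [mul_left_comm (m i) c] }

/-- The domain of `diagonalPMap` is `diagonalDomain` (by definition). [folklore] -/
@[simp]
theorem diagonalPMap_domain (m : ι → 𝕜) : (b.diagonalPMap m).domain = b.diagonalDomain m :=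
  rfl

/-- Coordinates of the diagonal operator: `⟪b i, diag(m) x⟫ = m i * ⟪b i, x⟫`. [folklore] -/
@[simp]
theorem repr_diagonalPMap_apply (m : ι → 𝕜) (x : b.diagonalDomain m) (i : ι) :
    b.repr (b.diagonalPMap m x) i = m i * b.repr (x : H) i := by
  simp [diagonalPMap, LinearPMap.mk_apply]

/-- The diagonal operator acts on basis vectors by `diag(m) (b i) = m i • b i`. [folklore] -/
theorem diagonalPMap_apply_basis (m : ι → 𝕜) (i : ι) :
    b.diagonalPMap m ⟨b i, b.basis_mem_diagonalDomain m i⟩ = m i • b i := by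
  classical
  apply b.repr.injective
  ext j
  rw [repr_diagonalPMap_apply]
  by_cases h : j = i
  · subst h; simp [b.repr_self]
  · simp [b.repr_self, Pi.single_eq_of_ne h]

end PMap

/-! ### Bounded diagonal operators -/

section CLM

/-- The underlying linear map of `diagonalCLM` (implementation detail; use `diagonalCLM`). [folklore] -/
def diagonalLinearMap (m : lp (fun _ : ι => 𝕜) ∞) : H →ₗ[𝕜] H where
  toFun x := b.repr.symm
    ⟨fun i => m i * b.repr x i, (lp.memℓp m).infty_mul_left (lp.memℓp (b.repr x))⟩
  map_add' x y := by
    rw [← map_add]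
    congr 1
    ext i
    simp [mul_add]
  map_smul' c x := by
    rw [RingHom.id_apply, ← LinearIsometryEquiv.map_smul]
    congr 1
    ext i
    simp [mul_left_comm (m i) c]

/-- Coordinates of `diagonalLinearMap`. [folklore] -/
theorem repr_diagonalLinearMap_apply (m : lp (fun _ : ι => 𝕜) ∞) (x : H) (i : ι) :
    b.repr (b.diagonalLinearMap m x) i = m i * b.repr x i := by
  simp [diagonalLinearMap]

/-- The operator bound `‖diag(m) x‖ ≤ ‖m‖_∞ ‖x‖` (Halmos, *A Hilbert Space Problem Book*,
Problem 61). [folklore] -/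
theorem norm_diagonalLinearMap_apply_le (m : lp (fun _ : ι => 𝕜) ∞) (x : H) :
    ‖b.diagonalLinearMap m x‖ ≤ ‖m‖ * ‖x‖ := by
  rw [← b.repr.norm_map (b.diagonalLinearMap m x), ← b.repr.norm_map x]
  have hk : ‖((‖m‖ : ℝ) : 𝕜)‖ = ‖m‖ := by rw [RCLike.norm_ofReal, abs_norm]
  calc ‖b.repr (b.diagonalLinearMap m x)‖ ≤ ‖((‖m‖ : ℝ) : 𝕜) • b.repr x‖ := by
        refine lp.norm_mono two_ne_zero fun i => ?_
        rw [repr_diagonalLinearMap_apply, lp.coeFn_smul, Pi.smul_apply, smul_eq_mul, norm_mul,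
          norm_mul, hk]
        exact mul_le_mul_of_nonneg_right (lp.norm_apply_le_norm ENNReal.top_ne_zero m i)
          (norm_nonneg _)
    _ = ‖m‖ * ‖b.repr x‖ := by rw [lp.norm_const_smul two_ne_zero, hk]

/-- (Dot-notation extension of Mathlib's `HilbertBasis`.) The bounded diagonal operator with
bounded symbol `m ∈ ℓ^∞(ι, 𝕜)` in the Hilbert basis `b`: `x ↦ ∑ m i ⟪b i, x⟫ b i`, a
continuous linear map of norm `≤ ‖m‖_∞` (Halmos, *A Hilbert Space Problem Book*, Problems 61–63;
Conway, *A Course in Functional Analysis*, II Proposition 1.5). [folklore] -/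
def diagonalCLM (m : lp (fun _ : ι => 𝕜) ∞) : H →L[𝕜] H :=
  (b.diagonalLinearMap m).mkContinuous ‖m‖ (b.norm_diagonalLinearMap_apply_le m)

/-- Coordinates of the bounded diagonal operator: `⟪b i, diag(m) x⟫ = m i * ⟪b i, x⟫`. [folklore] -/
@[simp]
theorem diagonalCLM_apply_repr (m : lp (fun _ : ι => 𝕜) ∞) (x : H) (i : ι) :
    b.repr (b.diagonalCLM m x) i = m i * b.repr x i :=
  b.repr_diagonalLinearMap_apply m x i

/-- `diag(m) (b i) = m i • b i`. [folklore] -/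
theorem diagonalCLM_basis (m : lp (fun _ : ι => 𝕜) ∞) (i : ι) :
    b.diagonalCLM m (b i) = m i • b i := by
  classical
  apply b.repr.injective
  ext j
  rw [diagonalCLM_apply_repr]
  by_cases h : j = i
  · subst h; simp [b.repr_self]
  · simp [b.repr_self, Pi.single_eq_of_ne h]

/-- `diag(1) = 1` (the functional calculus `ℓ^∞ → B(H)` is unital). [folklore] -/
@[simp]
theorem diagonalCLM_one : b.diagonalCLM (1 : lp (fun _ : ι => 𝕜) ∞) = 1 := by
  ext x
  apply b.repr.injective
  ext i
  simp [lp.infty_coeFn_one]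

/-- `diag(m n) = diag(m) diag(n)` (the functional calculus `ℓ^∞ → B(H)` is multiplicative;
Halmos, Problem 62). [folklore] -/
theorem diagonalCLM_mul (m n : lp (fun _ : ι => 𝕜) ∞) :
    b.diagonalCLM (m * n) = b.diagonalCLM m * b.diagonalCLM n := by
  ext x
  apply b.repr.injective
  ext i
  simp [lp.infty_coeFn_mul, mul_assoc]

/-- `‖diag(m)‖ ≤ ‖m‖_∞` (with equality when `ι` is nonempty; Halmos, Problem 61). [folklore] -/
theorem norm_diagonalCLM_le (m : lp (fun _ : ι => 𝕜) ∞) : ‖b.diagonalCLM m‖ ≤ ‖m‖ :=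
  LinearMap.mkContinuous_norm_le _ (norm_nonneg _) _

/-- The adjoint of a bounded diagonal operator is the diagonal operator with conjugate symbol,
`diag(m)† = diag(m̄)` (Halmos, Problem 63; Conway II, Proposition 2.4). [folklore] -/
theorem adjoint_diagonalCLM [CompleteSpace H] (m : lp (fun _ : ι => 𝕜) ∞) :
    ContinuousLinearMap.adjoint (b.diagonalCLM m) = b.diagonalCLM (star m) := by
  refine ((ContinuousLinearMap.eq_adjoint_iff _ _).mpr fun x y => ?_).symm
  rw [← b.repr.inner_map_map, ← b.repr.inner_map_map x, lp.inner_eq_tsum, lp.inner_eq_tsum]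
  refine tsum_congr fun i => ?_
  simp only [diagonalCLM_apply_repr, RCLike.inner_apply, map_mul, lp.star_apply,
    RCLike.star_def, RCLike.conj_conj]
  ring

/-- The bounded diagonal operator, viewed as a `LinearPMap` on `⊤`, is the maximal diagonal
operator with the same symbol (whose domain is then everything,
`diagonalDomain_eq_top_of_memℓp_infty`). [folklore] -/
theorem diagonalCLM_toPMap_eq_diagonalPMap (m : lp (fun _ : ι => 𝕜) ∞) :
    LinearMap.toPMap (b.diagonalCLM m : H →ₗ[𝕜] H) ⊤ = b.diagonalPMap m := by
  refine LinearPMap.ext (b.diagonalDomain_eq_top_of_memℓp_infty (lp.memℓp m)).symm ?_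
  intro x _ hx
  rw [LinearMap.toPMap_apply]
  apply b.repr.injective
  ext i
  rw [repr_diagonalPMap_apply]
  exact b.diagonalCLM_apply_repr m x i

end CLM

/-! ### Symmetry, positivity, eigenvalues and spectrum -/

section Spectral

/-- A diagonal operator with real symbol (`star m = m`) is symmetric
(Reed–Simon I, §VIII.3, Proposition 1). [folklore] -/
theorem isSymmetric_diagonalPMap {m : ι → 𝕜} (hm : IsSelfAdjoint m) :
    (b.diagonalPMap m).IsSymmetric := by
  intro x y
  rw [← b.repr.inner_map_map, ← b.repr.inner_map_map (x : H), lp.inner_eq_tsum,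
    lp.inner_eq_tsum]
  refine tsum_congr fun i => ?_
  have hi : conj (m i) = m i := congr_fun hm i
  simp only [repr_diagonalPMap_apply, RCLike.inner_apply, map_mul, hi]
  ring

/-- A diagonal operator with real symbol is self-adjoint on its maximal domain
(Reed–Simon I, §VIII.3, Proposition 1). [cite: ReedSimonI1980, §VIII.3 Proposition 1] -/
def isSelfAdjoint_diagonalPMap : Prop :=
  ∀ [CompleteSpace H] {m : ι → 𝕜} (hm : IsSelfAdjoint m),
    IsSelfAdjoint (b.diagonalPMap m)

/-- A diagonal operator with real symbol is positive iff its symbol has non-negative real part,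
`0 ≤ re (m i)` for all `i` (Reed–Simon I, §VIII.3; the quadratic form is
`∑ re (m i) |⟪b i, x⟫|²`). [folklore] -/
theorem isPositive_diagonalPMap_iff {m : ι → 𝕜} (hm : IsSelfAdjoint m) :
    (b.diagonalPMap m).IsPositive ↔ ∀ i, 0 ≤ re (m i) := by
  refine ⟨fun h i => ?_, fun h => ⟨b.isSymmetric_diagonalPMap hm, fun x => ?_⟩⟩
  · have := h.re_inner_nonneg ⟨b i, b.basis_mem_diagonalDomain m i⟩
    rw [diagonalPMap_apply_basis, inner_smul_right, inner_self_eq_norm_sq_to_K,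
      b.orthonormal.1 i] at this
    simpa using this
  · rw [← b.repr.inner_map_map, lp.inner_eq_tsum, RCLike.re_tsum (h := lp.summable_inner _ _)]
    refine tsum_nonneg fun i => ?_
    rw [repr_diagonalPMap_apply, ← smul_eq_mul, inner_smul_right, inner_self_eq_norm_sq_to_K,
      ← RCLike.ofReal_pow, RCLike.re_mul_ofReal]
    exact mul_nonneg (h i) (sq_nonneg _)

/-- Each basis vector `b i` is an eigenvector of `diag(m)` with eigenvalue `m i`. [folklore] -/
theorem hasEigenvector_diagonalPMap_basis (m : ι → 𝕜) (i : ι) :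
    (b.diagonalPMap m).HasEigenvector (m i) (b i) :=
  ⟨LinearPMap.mem_eigenspace_iff.mpr
      ⟨b.basis_mem_diagonalDomain m i, b.diagonalPMap_apply_basis m i⟩,
    b.orthonormal.ne_zero i⟩

/-- The eigenvalues of `diag(m)` are exactly the values of the symbol
(Reed–Simon I, §VIII.1, Example 1). [folklore] -/
theorem hasEigenvalue_diagonalPMap_iff {m : ι → 𝕜} {μ : 𝕜} :
    (b.diagonalPMap m).HasEigenvalue μ ↔ μ ∈ Set.range m := by
  constructor
  · intro h
    obtain ⟨x, hx, hx0⟩ := LinearPMap.hasEigenvalue_iff.mp h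
    obtain ⟨hxd, hAx⟩ := LinearPMap.mem_eigenspace_iff.mp hx
    have hc : b.repr x ≠ 0 := by simpa using hx0
    obtain ⟨i, hi⟩ : ∃ i, b.repr x i ≠ 0 := by
      by_contra! h'
      exact hc (lp.ext (funext h'))
    refine ⟨i, mul_right_cancel₀ hi ?_⟩
    have := congr_arg (fun z => b.repr z i) hAx
    simpa using this
  · rintro ⟨i, rfl⟩
    exact LinearPMap.hasEigenvalue_iff.mpr ⟨b i, b.hasEigenvector_diagonalPMap_basis m i⟩

/-- The eigenspace of `diag(m)` for `μ` is the closed span of the basis vectors `b i` with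
`m i = μ` (Reed–Simon I, §VIII.1, Example 1). [cite: ReedSimonI1980, §VIII.1 Example 1] -/
def eigenspace_diagonalPMap : Prop :=
  ∀ (m : ι → 𝕜) (μ : 𝕜),
    (b.diagonalPMap m).eigenspace μ = (span 𝕜 (b '' {i | m i = μ})).topologicalClosure

/-- The spectrum of a bounded diagonal operator is the closure of the range of its symbol
(Halmos, *A Hilbert Space Problem Book*, Problem 63; Conway VII, Example 3.2 ff.). [cite: HalmosHSPB1982, Problem 63] -/
def spectrum_diagonalCLM : Prop :=
  ∀ (m : lp (fun _ : ι => 𝕜) ∞),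
    spectrum 𝕜 (b.diagonalCLM m) = closure (Set.range (⇑m : ι → 𝕜))

/-- Sanity check for `LinearPMap.HasGroundStateGap`: for a real symbol `m` with `m i₀ = 0`,
the diagonal operator has ground state `b i₀` with gap `Δ` iff `0 < Δ` and all other diagonal
entries satisfy `Δ ≤ m i` (Reed–Simon IV, §XIII.1: for a diagonal operator the min–max values
are the ordered diagonal entries). [cite: ReedSimonIV1978, §XIII.1 (min–max values of a diagonal operator)] -/
def hasGroundStateGap_diagonalPMap_iff : Prop :=
  ∀ [CompleteSpace H] {m : ι → 𝕜} (hm : IsSelfAdjoint m) {i₀ : ι} (h₀ : m i₀ = 0) {Δ : ℝ},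
    (b.diagonalPMap m).HasGroundStateGap (b i₀) Δ ↔ 0 < Δ ∧ ∀ i, i ≠ i₀ → Δ ≤ re (m i)

end Spectral

/-! ### Discharge of `eigenspace_diagonalPMap` -/

section EigenspaceProof

/-- Membership in an eigenspace of the diagonal operator, in coordinates: `x` lies in the
`μ`-eigenspace of `diag(m)` iff its coordinates vanish at every index `i` with `m i ≠ μ`
(then `x` is automatically in the maximal domain, `m · c = μ · c ∈ ℓ²`)
(Reed–Simon I, §VIII.1, Example 1: the multiplication operator on its maximal domain). [folklore] -/
theorem mem_eigenspace_diagonalPMap_iff {m : ι → 𝕜} {μ : 𝕜} {x : H} :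
    x ∈ (b.diagonalPMap m).eigenspace μ ↔ ∀ i, m i ≠ μ → b.repr x i = 0 := by
  rw [LinearPMap.mem_eigenspace_iff]
  constructor
  · rintro ⟨hxd, hAx⟩ i hi
    by_contra h
    have := congr_arg (fun z => b.repr z i) hAx
    simp only [repr_diagonalPMap_apply, LinearIsometryEquiv.map_smul, lp.coeFn_smul,
      Pi.smul_apply, smul_eq_mul] at this
    exact hi (mul_right_cancel₀ h this)
  · intro h
    have key : (fun i => m i * b.repr x i) = fun i => μ * b.repr x i := by
      ext i
      by_cases hi : m i = μ
      · rw [hi]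
      · rw [h i hi, mul_zero, mul_zero]
    have hxd : x ∈ b.diagonalDomain m := by
      rw [mem_diagonalDomain_iff, key]
      exact (lp.memℓp (b.repr x)).const_mul μ
    refine ⟨hxd, b.repr.injective ?_⟩
    ext i
    rw [repr_diagonalPMap_apply, LinearIsometryEquiv.map_smul, lp.coeFn_smul, Pi.smul_apply,
      smul_eq_mul]
    exact congr_fun key i

/-- The closed span of a subfamily `b '' S` of a Hilbert basis consists of the vectors whose
coordinates vanish off `S` (from `HilbertBasis.hasSum_repr` and orthonormality). [folklore] -/
theorem mem_topologicalClosure_span_image_iff (S : Set ι) (x : H) :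
    x ∈ (span 𝕜 (b '' S)).topologicalClosure ↔ ∀ i, i ∉ S → b.repr x i = 0 := by
  constructor
  · intro hx i hi
    have hle : (span 𝕜 (b '' S)).topologicalClosure ≤ (span 𝕜 (b '' Sᶜ))ᗮ := by
      refine Submodule.topologicalClosure_minimal _ ?_ (Submodule.isClosed_orthogonal _)
      rw [← Submodule.isOrtho_iff_le, Submodule.isOrtho_span]
      rintro _ ⟨j, hj, rfl⟩ _ ⟨k, hk, rfl⟩
      exact b.orthonormal.inner_eq_zero fun hjk => hk (hjk ▸ hj)
    rw [b.repr_apply_apply]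
    exact Submodule.inner_right_of_mem_orthogonal (K := span 𝕜 (b '' Sᶜ))
      (subset_span ⟨i, hi, rfl⟩) (hle hx)
  · intro h
    rw [← SetLike.mem_coe, Submodule.topologicalClosure_coe]
    refine mem_closure_of_tendsto (b.hasSum_repr x) (Filter.Eventually.of_forall fun s => ?_)
    refine Submodule.sum_mem _ fun i _ => ?_
    by_cases hi : i ∈ S
    · exact Submodule.smul_mem _ _ (subset_span ⟨i, hi, rfl⟩)
    · rw [h i hi, zero_smul]
      exact zero_mem _

/-- Discharge of the named fact `eigenspace_diagonalPMap`: the `μ`-eigenspace of `diag(m)` is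
the closed span of the basis vectors `b i` with `m i = μ`; both sides are the vectors whose
coordinates vanish at the indices `i` with `m i ≠ μ`
(Reed–Simon I, §VIII.1, Example 1, p. 250: the multiplication operator `φ ↦ x φ` on its
maximal domain; here in the discrete form `c ↦ m c` on `ℓ²(ι)` transported along `b.repr`).
[cite: ReedSimonI1980, §VIII.1 Example 1] -/
theorem eigenspace_diagonalPMap_holds : b.eigenspace_diagonalPMap := by
  intro m μ
  ext x
  rw [mem_eigenspace_diagonalPMap_iff, mem_topologicalClosure_span_image_iff]
  rfl

end EigenspaceProof

end HilbertBasis
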